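import Literature.Probability.RandomPlanarGeometry.SAWRestrictionCovariance
import Summits.CriticalPhenomena.SAWScalingLimit.Theorems.SAWTotalPositivityTPToTraversalBoundChain
import HarnessLib

/-!
# Screening recursion for `SAWCircleScreening`, part I: cylinders of the critical SAW law

Route `SAWCircleScreening` of `CriticalPhenomena/SAWScalingLimit`, support item
`ScreeningRecursion` (stmt-CriticalPhenomena-5468): `ScreenOverlap → NoDeepReturn →
EndpointCouplingTame`. The proof is a total-variation contraction across scales driven by two
exact identities of the critical SAW law `P_δ(γ) ∝ x_c^{|γ|}` (`SAW.law`): the domain Markov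
property (conditioning on an initial segment) and the exact screen (conditioning on a circle
crossed exactly once). Both are instances of ONE combinatorial identity, proved here:

* `weight_univ_ne_top` — the partition function of a bounded discrete domain is finite (the SAW
  space is finite, `TPToTraversalBound.Radial.finite_domainSAW` of the tree);
* `weight_cylinder_split`, `law_cylinder_split` — **cylinder factorisation**: if the SAWs of
  `Ω_δ` from `a` to `b` that start with a given vertex list `pre` (ending at `v`) are exactly the
  concatenations of `pre` with the SAWs of another discrete domain `Ω'_δ` from `v` to `b`
  (hypotheses `T1`, `T2`, stated through supports), then for every set `T` of vertex lists
  `law Ω {pre ≼ γ ∧ suffix γ ∈ T} = law Ω {pre ≼ γ} · law Ω' {support ∈ T}`.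

Folklore (the configurational/Gibbs structure of the weights `x_c^{|γ|}`; cf.
Lawler–Schramm–Werner 2004, §3.1, and Madras–Slade 1993, §1.2). Mathlib anchors:
`Function.Injective.tsum_eq`, `SimpleGraph.Walk.support_injective`, `List.IsPrefix`.
-/

noncomputable section

open MeasureTheory Set
open scoped ENNReal
open Literature.Probability.LatticeModels
open Literature.Probability.RandomPlanarGeometry
open Literature.Probability.RandomPlanarGeometry.SAW

namespace Summit.CriticalPhenomena.SAWScalingLimit.Theorems.ScreeningRecursion

variable {Ω Ω' : Set ℂ} {δ : ℝ} {a v b : Site 2}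

/-! ## Finiteness of the SAW space -/

/-- The total weight of a bounded discrete domain is finite. [folklore] -/
theorem weight_univ_ne_top (hΩ : Bornology.IsBounded Ω) (hδ : 0 < δ) (u v : Site 2) :
    weight Ω δ u v univ ≠ ⊤ := by
  haveI := TPToTraversalBound.Radial.finite_domainSAW hΩ hδ u v
  haveI := Fintype.ofFinite (DomainSAW Ω δ u v)
  rw [weight_apply_eq_tsum_indicator, tsum_fintype]
  exact (ENNReal.sum_lt_top.2 fun γ _ => by
    rw [indicator_of_mem (mem_univ _)]; exact ENNReal.ofReal_lt_top).ne

/-- The law gives every event mass at most `1` (all junk cases included). [folklore] -/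
theorem law_apply_le_one (S : Set (DomainSAW Ω δ a b)) : law Ω δ a b S ≤ 1 := by
  rw [law_apply_eq_inv_mul_weight]
  calc (weight Ω δ a b univ)⁻¹ * weight Ω δ a b S
      ≤ (weight Ω δ a b univ)⁻¹ * weight Ω δ a b univ := by gcongr; exact subset_univ _
    _ ≤ 1 := ENNReal.inv_mul_le_one _

/-- The law gives every event finite mass. [folklore] -/
theorem law_apply_ne_top (S : Set (DomainSAW Ω δ a b)) : law Ω δ a b S ≠ ⊤ :=
  ne_top_of_le_ne_top ENNReal.one_ne_top (law_apply_le_one S)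

/-- The law is a probability measure as soon as the total weight is positive and finite.
[folklore] -/
theorem law_univ_eq_one (h0 : weight Ω δ a b univ ≠ 0) (htop : weight Ω δ a b univ ≠ ⊤) :
    law Ω δ a b univ = 1 := by
  rw [law_apply_eq_inv_mul_weight, ENNReal.inv_mul_cancel h0 htop]

/-- A nonempty SAW space has positive total weight (`x_c > 0` is not even needed: `x_c ^ n` is
real and `ENNReal.ofReal` of it is the weight; we use `0 < x_c` from the infimum definition).
More precisely: the weight of a set containing `γ` is at least `x_c^{|γ|}`. [folklore] -/
theorem weight_singleton_le_of_mem {S : Set (DomainSAW Ω δ a b)} {γ : DomainSAW Ω δ a b}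
    (hγ : γ ∈ S) : ENNReal.ofReal (criticalFugacity ^ γ.length) ≤ weight Ω δ a b S := by
  rw [← weight_singleton γ]
  exact measure_mono (singleton_subset_iff.2 hγ)

/-! ## Cylinder factorisation -/

/-- Dropping the first `pre.length - 1` entries of `pre.dropLast ++ l` leaves `l`. [folklore] -/
theorem drop_dropLast_append (pre l : List (Site 2)) :
    (pre.dropLast ++ l).drop (pre.length - 1) = l := by
  have h : pre.dropLast.length = pre.length - 1 := List.length_dropLast
  rw [← h, List.drop_left]

/-- A nonempty list is a prefix of `pre.dropLast ++ l` as soon as `l` starts with its last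
element. [folklore] -/
theorem prefix_dropLast_append {pre l : List (Site 2)} (hpre : pre ≠ [])
    (hl : l.head? = some (pre.getLast hpre)) : pre <+: pre.dropLast ++ l := by
  obtain ⟨x, l', rfl⟩ : ∃ x l', l = x :: l' := by
    cases l with
    | nil => simp at hl
    | cons x l' => exact ⟨x, l', rfl⟩
  simp only [List.head?_cons, Option.some.injEq] at hl
  subst hl
  refine ⟨l', ?_⟩
  have h := List.dropLast_append_getLast hpre
  calc pre ++ l' = (pre.dropLast ++ [pre.getLast hpre]) ++ l' := by rw [h]
    _ = pre.dropLast ++ pre.getLast hpre :: l' := by simp [List.append_assoc]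

/-- The support of a walk from `v` starts with `v`. [folklore] -/
theorem head?_support {G : SimpleGraph (Site 2)} {v b : Site 2} (p : G.Walk v b) :
    p.support.head? = some v := by
  cases p <;> rfl

/-- **Cylinder factorisation of the critical SAW weight.** Let `pre` be a nonempty vertex list
ending at `v`. Suppose (`T1`) every SAW `β'` of `Ω'_δ` from `v` to `b` concatenates with `pre` to
a SAW of `Ω_δ` from `a` to `b`, and (`T2`) every SAW of `Ω_δ` from `a` to `b` starting with `pre`
arises this way. Then for every set `T` of vertex lists, the `Ω`-weight of
`{pre ≼ γ, suffix(γ) ∈ T}` is `x_c^{|pre|-1}` times the `Ω'`-weight of `{support ∈ T}`.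
[folklore] -/
theorem weight_cylinder_split (pre : List (Site 2)) (hpre : pre ≠ [])
    (hlast : pre.getLast hpre = v)
    (T1 : ∀ β' : DomainSAW Ω' δ v b, ∃ γ : DomainSAW Ω δ a b,
      γ.walk.support = pre.dropLast ++ β'.walk.support)
    (T2 : ∀ γ : DomainSAW Ω δ a b, pre <+: γ.walk.support →
      ∃ β' : DomainSAW Ω' δ v b, γ.walk.support = pre.dropLast ++ β'.walk.support)
    (T : Set (List (Site 2))) :
    weight Ω δ a b {γ | pre <+: γ.walk.support ∧ γ.walk.support.drop (pre.length - 1) ∈ T} =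
      ENNReal.ofReal (criticalFugacity ^ (pre.length - 1)) *
        weight Ω' δ v b {β' | β'.walk.support ∈ T} := by
  classical
  choose ι hι using T1
  have hinj : Function.Injective ι := by
    intro β₁ β₂ h
    apply DomainSAW.ext_support
    have := hι β₁
    rw [h, hι β₂] at this
    exact List.append_cancel_left this.symm
  -- lengths
  have hlen : ∀ β', (ι β').length = (pre.length - 1) + β'.length := by
    intro β'
    have h1 := congrArg List.length (hι β')
    rw [SimpleGraph.Walk.length_support, List.length_append, List.length_dropLast,
      SimpleGraph.Walk.length_support] at h1
    show (ι β').walk.length = pre.length - 1 + β'.walk.length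
    omega
  -- the cylinder event is the range of `ι`
  set S : Set (DomainSAW Ω δ a b) :=
    {γ | pre <+: γ.walk.support ∧ γ.walk.support.drop (pre.length - 1) ∈ T} with hS
  have hmemS : ∀ β', ι β' ∈ S ↔ β'.walk.support ∈ T := by
    intro β'
    simp only [hS, mem_setOf_eq, hι β', drop_dropLast_append]
    constructor
    · exact fun h => h.2
    · intro h
      refine ⟨prefix_dropLast_append hpre ?_, h⟩
      rw [head?_support, hlast]
  have hrange : ∀ γ ∈ S, γ ∈ Set.range ι := by
    intro γ hγ
    obtain ⟨β', hβ'⟩ := T2 γ hγ.1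
    refine ⟨β', DomainSAW.ext_support ?_⟩
    rw [hι β', hβ']
  rw [weight_apply_eq_tsum_indicator, weight_apply_eq_tsum_indicator, ← ENNReal.tsum_mul_left]
  have hsupp : Function.support
      (S.indicator fun γ : DomainSAW Ω δ a b => ENNReal.ofReal (criticalFugacity ^ γ.length)) ⊆
      Set.range ι := by
    intro γ hγ
    exact hrange γ (Set.mem_of_indicator_ne_zero hγ)
  rw [← hinj.tsum_eq hsupp]
  refine tsum_congr fun β' => ?_
  set S' : Set (DomainSAW Ω' δ v b) := {β' | β'.walk.support ∈ T} with hS'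
  by_cases hT : β'.walk.support ∈ T
  · have hT' : β' ∈ S' := hT
    rw [indicator_of_mem ((hmemS β').2 hT), indicator_of_mem hT',
      hlen β', pow_add, ENNReal.ofReal_mul (pow_nonneg ?_ _)]
    exact inv_nonneg.2 (Real.iInf_nonneg fun n => Real.rpow_nonneg (Nat.cast_nonneg _) _)
  · have hT' : β' ∉ S' := hT
    rw [indicator_of_notMem (fun h => hT ((hmemS β').1 h)), indicator_of_notMem hT', mul_zero]

/-- The cylinder itself: `weight Ω {pre ≼ γ} = x_c^{|pre|-1} · weight Ω' univ`. [folklore] -/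
theorem weight_cylinder (pre : List (Site 2)) (hpre : pre ≠ []) (hlast : pre.getLast hpre = v)
    (T1 : ∀ β' : DomainSAW Ω' δ v b, ∃ γ : DomainSAW Ω δ a b,
      γ.walk.support = pre.dropLast ++ β'.walk.support)
    (T2 : ∀ γ : DomainSAW Ω δ a b, pre <+: γ.walk.support →
      ∃ β' : DomainSAW Ω' δ v b, γ.walk.support = pre.dropLast ++ β'.walk.support) :
    weight Ω δ a b {γ | pre <+: γ.walk.support} =
      ENNReal.ofReal (criticalFugacity ^ (pre.length - 1)) * weight Ω' δ v b univ := by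
  have h := weight_cylinder_split pre hpre hlast T1 T2 univ
  simp only [mem_univ, and_true, setOf_true] at h
  exact h

/-- **Cylinder factorisation of the critical SAW law** (domain Markov property / exact screen in
one statement): under `T1`, `T2`,
`law Ω {pre ≼ γ ∧ suffix γ ∈ T} = law Ω {pre ≼ γ} · law Ω' {support ∈ T}`, all junk cases
included (the right factor's total weight must be finite, which holds for bounded domains,
`weight_univ_ne_top`). [folklore] -/
theorem law_cylinder_split (pre : List (Site 2)) (hpre : pre ≠ []) (hlast : pre.getLast hpre = v)
    (T1 : ∀ β' : DomainSAW Ω' δ v b, ∃ γ : DomainSAW Ω δ a b,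
      γ.walk.support = pre.dropLast ++ β'.walk.support)
    (T2 : ∀ γ : DomainSAW Ω δ a b, pre <+: γ.walk.support →
      ∃ β' : DomainSAW Ω' δ v b, γ.walk.support = pre.dropLast ++ β'.walk.support)
    (hfin : weight Ω' δ v b univ ≠ ⊤) (T : Set (List (Site 2))) :
    law Ω δ a b {γ | pre <+: γ.walk.support ∧ γ.walk.support.drop (pre.length - 1) ∈ T} =
      law Ω δ a b {γ | pre <+: γ.walk.support} * law Ω' δ v b {β' | β'.walk.support ∈ T} := by
  rw [law_apply_eq_inv_mul_weight, law_apply_eq_inv_mul_weight, law_apply_eq_inv_mul_weight,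
    weight_cylinder_split pre hpre hlast T1 T2 T, weight_cylinder pre hpre hlast T1 T2]
  set Z := weight Ω δ a b univ
  set Z' := weight Ω' δ v b univ
  set c := ENNReal.ofReal (criticalFugacity ^ (pre.length - 1))
  set W := weight Ω' δ v b {β' | β'.walk.support ∈ T}
  by_cases hZ' : Z' = 0
  · have hW : W = 0 := le_antisymm (le_trans (measure_mono (subset_univ _)) hZ'.le) bot_le
    simp [hW]
  · calc Z⁻¹ * (c * W) = Z⁻¹ * (c * (Z' * Z'⁻¹) * W) := by
          rw [ENNReal.mul_inv_cancel hZ' hfin, mul_one]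
      _ = Z⁻¹ * (c * Z') * (Z'⁻¹ * W) := by ring

end Summit.CriticalPhenomena.SAWScalingLimit.Theorems.ScreeningRecursion

end
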